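import Mathlib
import Summits.ValiantsHypothesis.ValiantsHypothesis.Theorems.TriangularDimersDivisionEasy.Negative.Gluing
import Summits.ValiantsHypothesis.ValiantsHypothesis.Theorems.TriangularDimersDivisionEasy.Negative.Rectangle

/-!
# `TriangularDimersDivisionEasy` — negative-side toolkit 5: peeling gadgets (the rectangle bound)

Crux `stmt-ValiantsHypothesis-5067` (`Theses.DivisionGap.TriangularDimersDivisionEasy`, route
DivisionGap).  Standing disprover (cdisprove gen 1); step V4 of the load-bearing lemma
`false_without_division` (Valiant 1980, Thm 1, for the rhombus).

Given pairwise far-apart validly placed gadgets `G` whose centre edges are MIXED for a row set `A`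
(one end in `A`, one not), every rectangle (`a` ordered by `A`, `b` by `Aᶜ`, `a * b ≤ D_n`) satisfies
`T ^ |G| · |supp (a * b)| ≤ (T - 1) ^ |G| · #(dimer covers of R_n)` with `T = 6 ^ 44`
(`rect_card_le`): by `rect_uniform` the rectangle lies in the family of covers with prescribed
status of every centre edge, and each gadget, peeled off in turn (`peel`), costs a factor `(T-1)/T`
because in every fibre (cover fixed outside the gadget; at most `T` completions, `card_fibre_le`) the
gadget lemma provides a completion with the wrong status (`exists_two_covers`).
[folklore]
-/

namespace Summit.ValiantsHypothesis.ValiantsHypothesis.Theorems.TriangularDimersDivisionEasy.Negative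

open Literature.Computability.AlgebraicComplexity
open MvPolynomial
open scoped BigOperators NNReal

set_option linter.dupNamespace false

noncomputable section

open Classical

variable {n : ℕ} (hn : 0 < n)

/-- A gadget placement: orientation and centre. [folklore] -/
abbrev Gad : Type := Bool × (ℤ × ℤ)

/-- The two ends of the centre edge of a placed gadget. [folklore] -/
def uOf (g : Gad) : Vtx n := vtx hn g.1 g.2 18

/-- The two ends of the centre edge of a placed gadget. [folklore] -/
def vOf (g : Gad) : Vtx n := vtx hn g.1 g.2 25

/-- The fibre size bound. [folklore] -/
def Tfib : ℕ := 6 ^ 44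

/-! ## At most six neighbours, hence at most `6^44` covers in a fibre -/

/-- Every vertex of `R_n` has at most six neighbours. [folklore] -/
theorem card_adj_le_six (x : Vtx n) : (Finset.univ.filter fun y => Adj x y).card ≤ 6 := by
  have hsub : ∀ y ∈ (Finset.univ.filter fun y => Adj x y),
      ((zof y).1 - (zof x).1, (zof y).2 - (zof x).2) ∈ dirs.toFinset := by
    intro y hy
    rw [Finset.mem_filter] at hy
    obtain ⟨d, hd, hyd⟩ := exists_dir_of_adjZ ((adj_iff_adjZ x y).1 hy.2)
    rw [List.mem_toFinset, hyd]
    simpa using hd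
  calc (Finset.univ.filter fun y => Adj x y).card
      ≤ dirs.toFinset.card := Finset.card_le_card_of_injOn _ hsub (by
          intro y _ y' _ h
          simp only [Prod.mk.injEq] at h
          apply zof_injective
          exact Prod.ext (by omega) (by omega))
    _ ≤ 6 := by decide

/-- The fibre map: a cover read outside the placed ball of `g`. [folklore] -/
def rho (g : Gad) (f : Vtx n → Vtx n) : Vtx n → Option (Vtx n) :=
  fun x => if InBall hn g.1 g.2 x then none else some (f x)

/-- Two covers have the same fibre image iff they agree outside the placed ball. [folklore] -/
theorem rho_eq_iff {g : Gad} {f f' : Vtx n → Vtx n} :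
    rho hn g f = rho hn g f' ↔ ∀ x, ¬ InBall hn g.1 g.2 x → f x = f' x := by
  constructor
  · intro h x hx
    have := congrFun h x
    simp only [rho, if_neg hx, Option.some.injEq] at this
    exact this
  · intro h
    funext x
    by_cases hx : InBall hn g.1 g.2 x
    · simp [rho, hx]
    · simp [rho, hx, h x hx]

/-- The fibre of `ω`. [folklore] -/
def fibre (g : Gad) (ω : Vtx n → Option (Vtx n)) : Finset (Vtx n → Vtx n) :=
  (dimers n).filter fun f => rho hn g f = ω

/-- A fibre has at most `6^44` covers (each inside vertex is matched to one of ≤ 6 neighbours). [folklore] -/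
theorem card_fibre_le (g : Gad) (ω : Vtx n → Option (Vtx n)) :
    (fibre hn g ω).card ≤ Tfib := by
  -- inject the fibre into the functions `Fin 44 → Vtx n` with values adjacent to the placed vertices
  set box : Finset (Fin 44 → Vtx n) :=
    Fintype.piFinset fun i : Fin 44 => Finset.univ.filter fun y => Adj (vtx hn g.1 g.2 i) y with hbox
  have hmaps : ∀ f ∈ fibre hn g ω, (fun i : Fin 44 => f (vtx hn g.1 g.2 i)) ∈ box := by
    intro f hf
    rw [Fintype.mem_piFinset]
    intro i
    rw [Finset.mem_filter]
    have hd : IsDimer f := (Finset.mem_filter.1 (Finset.mem_filter.1 hf).1).2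
    exact ⟨Finset.mem_univ _, (hd _).2.2⟩
  have hinj : Set.InjOn (fun f : Vtx n → Vtx n => fun i : Fin 44 => f (vtx hn g.1 g.2 i))
      (↑(fibre hn g ω) : Set (Vtx n → Vtx n)) := by
    intro f hf f' hf' h
    have hρ : rho hn g f = rho hn g f' := by
      rw [(Finset.mem_filter.1 (Finset.mem_coe.1 hf)).2, (Finset.mem_filter.1 (Finset.mem_coe.1 hf')).2]
    funext x
    by_cases hx : InBall hn g.1 g.2 x
    · obtain ⟨i, hi, rfl⟩ := hx
      exact congrFun h ⟨i, hi⟩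
    · exact (rho_eq_iff hn).1 hρ x hx
  calc (fibre hn g ω).card ≤ box.card := Finset.card_le_card_of_injOn _ hmaps hinj
    _ = ∏ i : Fin 44, (Finset.univ.filter fun y => Adj (vtx hn g.1 g.2 i) y).card :=
        Fintype.card_piFinset _
    _ ≤ ∏ _i : Fin 44, 6 := Finset.prod_le_prod' fun i _ => card_adj_le_six _
    _ = Tfib := by simp [Tfib]

/-! ## The constrained families and one peeling step -/

/-- Covers with prescribed status of the centre edge of every gadget in `G`. [folklore] -/
def Afam (σ : Gad → Prop) (G : List Gad) : Finset (Vtx n → Vtx n) :=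
  (dimers n).filter fun f => ∀ g ∈ G, (f (uOf hn g) = vOf hn g ↔ σ g)

/-- Membership in a constrained family. [folklore] -/
theorem mem_Afam {σ : Gad → Prop} {G : List Gad} {f : Vtx n → Vtx n} :
    f ∈ Afam hn σ G ↔ f ∈ dimers n ∧ ∀ g ∈ G, (f (uOf hn g) = vOf hn g ↔ σ g) := by
  simp [Afam]

/-- No constraints: all covers. [folklore] -/
theorem Afam_nil (σ : Gad → Prop) : Afam hn σ [] = dimers n := by
  ext f; simp [Afam]

/-- Adding a constraint shrinks the family. [folklore] -/
theorem Afam_cons_subset (σ : Gad → Prop) (g : Gad) (G : List Gad) : Afam hn σ (g :: G) ⊆ Afam hn σ G := by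
  intro f hf
  rw [mem_Afam] at hf ⊢
  exact ⟨hf.1, fun g' hg' => hf.2 g' (List.mem_cons_of_mem _ hg')⟩

/-- **One peeling step.** [folklore] -/
theorem peel_step (σ : Gad → Prop) (g : Gad) (G : List Gad) (hV : Valid n g.1 g.2)
    (hout : ∀ g' ∈ G, ¬ InBall hn g.1 g.2 (uOf hn g')) :
    Tfib * (Afam hn σ (g :: G)).card ≤ (Tfib - 1) * (Afam hn σ G).card := by
  set S₁ := Afam hn σ (g :: G) with hS₁
  set S₀ := Afam hn σ G with hS₀
  set I := S₁.image (rho hn g) with hI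
  -- fibres of S₁
  have hsum₁ : S₁.card = ∑ ω ∈ I, (S₁.filter fun f => rho hn g f = ω).card :=
    Finset.card_eq_sum_card_image _ _
  -- whole fibres lie in S₀ and have a missing element
  have hfib_sub : ∀ ω ∈ I, fibre hn g ω ⊆ S₀ := by
    intro ω hω f' hf'
    obtain ⟨f, hf, rfl⟩ := Finset.mem_image.1 hω
    rw [mem_Afam] at hf
    obtain ⟨hf'd, hρ⟩ := Finset.mem_filter.1 hf'
    rw [mem_Afam]
    refine ⟨hf'd, fun g' hg' => ?_⟩
    have := (rho_eq_iff hn).1 hρ (uOf hn g') (hout g' hg')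
    rw [this]
    exact hf.2 g' (List.mem_cons_of_mem _ hg')
  have hmissing : ∀ ω ∈ I, (S₁.filter fun f => rho hn g f = ω).card + 1 ≤ (fibre hn g ω).card := by
    intro ω hω
    obtain ⟨f, hf, rfl⟩ := Finset.mem_image.1 hω
    have hfd : f ∈ dimers n := (mem_Afam hn |>.1 hf).1
    obtain ⟨f₁, hf₁, f₂, hf₂, ho₁, ho₂, hne, heq⟩ := exists_two_covers hn g.1 g.2 f hV hfd
    have hρ₁ : rho hn g f₁ = rho hn g f := (rho_eq_iff hn).2 ho₁
    have hρ₂ : rho hn g f₂ = rho hn g f := (rho_eq_iff hn).2 ho₂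
    have hsub : (S₁.filter fun f' => rho hn g f' = rho hn g f) ⊆ fibre hn g (rho hn g f) := by
      intro f' hf'
      rw [Finset.mem_filter] at hf'
      exact Finset.mem_filter.2 ⟨(mem_Afam hn |>.1 hf'.1).1, hf'.2⟩
    -- one of f₁, f₂ has the wrong status at g
    have hbad : ∃ f' ∈ fibre hn g (rho hn g f), f' ∉ (S₁.filter fun f' => rho hn g f' = rho hn g f) := by
      by_cases hσ : σ g
      · refine ⟨f₁, Finset.mem_filter.2 ⟨hf₁, hρ₁⟩, fun h => ?_⟩
        have := ((mem_Afam hn).1 (Finset.mem_filter.1 h).1).2 g List.mem_cons_self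
        exact hne (this.2 hσ)
      · refine ⟨f₂, Finset.mem_filter.2 ⟨hf₂, hρ₂⟩, fun h => ?_⟩
        have := ((mem_Afam hn).1 (Finset.mem_filter.1 h).1).2 g List.mem_cons_self
        exact hσ (this.1 heq)
    obtain ⟨f', hf'mem, hf'not⟩ := hbad
    have hss : (S₁.filter fun f' => rho hn g f' = rho hn g f) ⊂ fibre hn g (rho hn g f) :=
      Finset.ssubset_iff_subset_ne.2 ⟨hsub, fun h => hf'not (h ▸ hf'mem)⟩
    exact Finset.card_lt_card hss
  -- sum up
  have hT : 1 ≤ Tfib := Nat.one_le_pow _ _ (by norm_num)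
  have step1 : Tfib * S₁.card ≤ (Tfib - 1) * ∑ ω ∈ I, (fibre hn g ω).card := by
    rw [hsum₁, Finset.mul_sum, Finset.mul_sum]
    apply Finset.sum_le_sum
    intro ω hω
    have h1 := hmissing ω hω
    have h2 := card_fibre_le hn g ω
    -- T * s ≤ (T-1) * F  when s + 1 ≤ F ≤ T
    have : Tfib * ((S₁.filter fun f => rho hn g f = ω).card + 1) ≤ Tfib * (fibre hn g ω).card :=
      Nat.mul_le_mul_left _ h1
    have h3 : (fibre hn g ω).card ≤ (Tfib - 1) * (fibre hn g ω).card + Tfib := by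
      calc (fibre hn g ω).card = 1 * (fibre hn g ω).card := (one_mul _).symm
        _ ≤ (Tfib - 1) * (fibre hn g ω).card + (fibre hn g ω).card := by
            have : 1 * (fibre hn g ω).card ≤ (Tfib - 1) * (fibre hn g ω).card + 1 * (fibre hn g ω).card :=
              le_add_self
            rwa [one_mul] at this ⊢
        _ ≤ (Tfib - 1) * (fibre hn g ω).card + Tfib := Nat.add_le_add_left h2 _
    have h4 : Tfib * (fibre hn g ω).card = (Tfib - 1) * (fibre hn g ω).card + (fibre hn g ω).card := by
      have : Tfib = (Tfib - 1) + 1 := (Nat.sub_add_cancel hT).symm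
      conv_lhs => rw [this]
      ring
    nlinarith [this, h3, h4]
  -- the fibres over I are disjoint parts of S₀
  have step2 : ∑ ω ∈ I, (fibre hn g ω).card ≤ S₀.card := by
    have hdisj : ∑ ω ∈ I, (fibre hn g ω).card = (I.biUnion fun ω => fibre hn g ω).card := by
      rw [Finset.card_biUnion]
      intro ω _ ω' _ hne
      rw [Function.onFun, Finset.disjoint_left]
      intro f hf hf'
      exact hne ((Finset.mem_filter.1 hf).2.symm.trans (Finset.mem_filter.1 hf').2)
    rw [hdisj]
    apply Finset.card_le_card
    intro f hf
    obtain ⟨ω, hω, hfω⟩ := Finset.mem_biUnion.1 hf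
    exact hfib_sub ω hω hfω
  calc Tfib * S₁.card ≤ (Tfib - 1) * ∑ ω ∈ I, (fibre hn g ω).card := step1
    _ ≤ (Tfib - 1) * S₀.card := Nat.mul_le_mul_left _ step2

/-- Far-apart placements: centres `≥ 8` apart in some coordinate. [folklore] -/
def Far (g g' : Gad) : Prop := 8 ≤ |g.2.1 - g'.2.1| ∨ 8 ≤ |g.2.2 - g'.2.2|

/-- Far-apart valid placements have disjoint balls. [folklore] -/
theorem not_inBall_of_far {g g' : Gad} (hfar : Far g g') (hV : Valid n g.1 g.2) (hV' : Valid n g'.1 g'.2)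
    {x : Vtx n} (hx : InBall hn g.1 g.2 x) : ¬ InBall hn g'.1 g'.2 x := by
  rintro ⟨j, hj, rfl⟩
  obtain ⟨i, hi, hxi⟩ := hx
  have := congrArg zof hxi
  rw [zof_vtx hn g.1 g.2 hV hi, zof_vtx hn g'.1 g'.2 hV' hj] at this
  obtain ⟨a1, a2, a3, a4⟩ := coord_bounds i (List.mem_range.2 hi)
  obtain ⟨b1, b2, b3, b4⟩ := coord_bounds j (List.mem_range.2 hj)
  obtain ⟨o, c⟩ := g
  obtain ⟨o', c'⟩ := g'
  simp only [Far] at hfar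
  cases o <;> cases o' <;> simp [place, Prod.ext_iff] at this <;> rcases hfar with h | h <;>
    rw [le_abs] at h <;> omega

/-- **Peeling all gadgets.** [folklore] -/
theorem peel (σ : Gad → Prop) :
    ∀ (G : List Gad), (∀ g ∈ G, Valid n g.1 g.2) → G.Pairwise Far →
      Tfib ^ G.length * (Afam hn σ G).card ≤ (Tfib - 1) ^ G.length * (dimers n).card := by
  intro G
  induction G with
  | nil => intro _ _; simp [Afam_nil]
  | cons g G ih =>
    intro hV hfar
    have hVg : Valid n g.1 g.2 := hV g List.mem_cons_self
    have hVG : ∀ g' ∈ G, Valid n g'.1 g'.2 := fun g' hg' => hV g' (List.mem_cons_of_mem _ hg')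
    have hpw := List.pairwise_cons.1 hfar
    have hout : ∀ g' ∈ G, ¬ InBall hn g.1 g.2 (uOf hn g') := by
      intro g' hg' hin
      have := not_inBall_of_far hn (hpw.1 g' hg') hVg (hVG g' hg') hin
      exact this (inBall_vtx hn g'.1 g'.2 (by norm_num))
    have h1 := peel_step hn σ g G hVg hout
    have h2 := ih hVG hpw.2
    calc Tfib ^ (g :: G).length * (Afam hn σ (g :: G)).card
        = Tfib ^ G.length * (Tfib * (Afam hn σ (g :: G)).card) := by rw [List.length_cons, pow_succ]; ring
      _ ≤ Tfib ^ G.length * ((Tfib - 1) * (Afam hn σ G).card) := Nat.mul_le_mul_left _ h1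
      _ = (Tfib - 1) * (Tfib ^ G.length * (Afam hn σ G).card) := by ring
      _ ≤ (Tfib - 1) * ((Tfib - 1) ^ G.length * (dimers n).card) := Nat.mul_le_mul_left _ h2
      _ = (Tfib - 1) ^ (g :: G).length * (dimers n).card := by rw [List.length_cons, pow_succ]; ring

/-! ## The rectangle bound -/

/-- **The rectangle bound.**  For a product term `a * b ≤ D_n`, `a` ordered by `A`, `b` by `Aᶜ`, and
far-apart valid gadgets whose centre edges are mixed for `A`:
`T^|G| · |supp (a * b)| ≤ (T-1)^|G| · #covers`. [folklore] -/
theorem rect_card_le (A : Finset (Vtx n)) {a b : MvPolynomial (Var n) ℝ≥0}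
    (ha : IsOrdered A a) (hb : IsOrdered Aᶜ b) (hdom : ∀ m, coeff m (a * b) ≤ coeff m (triPM n))
    (G : List Gad) (hV : ∀ g ∈ G, Valid n g.1 g.2) (hfar : G.Pairwise Far)
    (hmixed : ∀ g ∈ G, (uOf hn g ∈ A ∧ vOf hn g ∉ A) ∨ (uOf hn g ∉ A ∧ vOf hn g ∈ A)) :
    Tfib ^ G.length * (a * b).support.card ≤ (Tfib - 1) ^ G.length * (dimers n).card := by
  rw [card_support_mul_eq hdom]
  by_cases hemp : rect a b = ∅
  · simp [hemp]
  obtain ⟨f₀, hf₀⟩ := Finset.nonempty_iff_ne_empty.2 hemp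
  set σ : Gad → Prop := fun g => f₀ (uOf hn g) = vOf hn g with hσ
  have hsub : rect a b ⊆ Afam hn σ G := by
    intro f hf
    rw [mem_Afam]
    refine ⟨rect_subset_dimers hf, fun g hg => ?_⟩
    rcases hmixed g hg with ⟨hu, hv⟩ | ⟨hu, hv⟩
    · exact ⟨fun h => rect_uniform ha hb hdom hu hv hf hf₀ h, fun h => rect_uniform ha hb hdom hu hv hf₀ hf h⟩
    · exact ⟨fun h => rect_uniform' ha hb hdom hu hv hf hf₀ h, fun h => rect_uniform' ha hb hdom hu hv hf₀ hf h⟩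
  calc Tfib ^ G.length * (rect a b).card ≤ Tfib ^ G.length * (Afam hn σ G).card :=
        Nat.mul_le_mul_left _ (Finset.card_le_card hsub)
    _ ≤ (Tfib - 1) ^ G.length * (dimers n).card := peel hn σ G hV hfar

end

end Summit.ValiantsHypothesis.ValiantsHypothesis.Theorems.TriangularDimersDivisionEasy.Negative
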